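import Summits.HodgeConjecture.HodgeConjecture.Theorems.HLiu418E1pGram
import Summits.HodgeConjecture.HodgeConjecture.Theorems.HLiu418E1pHilbert
import Summits.HodgeConjecture.HodgeConjecture.Theorems.HLiu418E2LevelFinite
import Summits.HodgeConjecture.HodgeConjecture.Theorems.HLiu418E1pRealise
import Literature.NumberTheory.Automorphic.UnitaryCurveCohCotangentFormsConjRep
import HarnessLib

/-!
# Crux `HLiu418`, K-lane E1′₂ by the RANK-2 COLLAPSE — FILE D (core): from the DISC IDENTITY WITH VALUE and a REALISATION of `σ` in the
# holomorphic cotangent classes of `P`, `P′` to `P = P′` under multiplicity `≤ 1` (Schur scaling + equal matrix coefficients + GNS)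

Cell hodgecm-mathlib (D-0151), FLOOR 0, programme P5 (Alb-CM), crux item `HLiu418` = stmt-HodgeConjecture-24832; K-lane E1′₂, road
«`Rogawski1990.curveCohFinComponentUnique_hol` ⇐ `Rogawski1990.curveMultiplicityLeOne` ALONE» (pen F0P5-p02 (g3), cut
`F0/P5/p02/CENSUS-KE1prime-collapse.v0` ac70c5fe3da52d26: files A `HLiu418E1pArchCoefficient` (step 2, the disc identity with value) · B ★∕rf
`HLiu418E1pHilbert` (F0P5-p01 (g3), ★ p807900: GNS uniqueness + the E1-fold) · C `HLiu418E1pLevel` (A-p02 (g19): `σ` realised in `Hol(P)`) · D (this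
file, A-p04 (g21)): steps 4–5).  THEOREMS ONLY (no definition, no instance, no notation, no named fact, no `sorry`); `--supports
stmt-HodgeConjecture-24832 --as helper`.  HC_CM is proved only modulo the 7 printed citations until rung 0 closes; this file proves nothing about
them.

THE CORE THEOREM `eq_of_discIdentity_of_holRealised` (generic rank-2 unitary datum `U(J)`, `F ⊂ E`, `c`, complex place `w₁`, cone frame `𝔣`,
automorphic `μ` with compact quotient).  DATA: a scalar `m : U(σ_{w₁}J)(ℂ) → ℂ` with the DISC IDENTITY WITH VALUE
`⟪R(sec u)[h], [h₃]⟫ = m(u) · ⟪[h],[h₃]⟫` for all cone-holomorphic cotangent forms `h, h₃` (A's head); an irreducible ADMISSIBLE `σ` of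
`U(J)(𝔸_{F,f})` on `W`; for each of two discrete automorphic `P`, `P′` a NON-ZERO linear `ψ : W → (U(J)(𝔸_F) → ℂ)`, `rightRep₂`-equivariant, with
values in `holCotForms₂ 𝔣 ∩ P.ContainsFun` (C's head, twice); multiplicity `≤ 1` of `P` in `L²` (the E1 letter at `P`).  CONCLUSION: `P = P′`.
PROOF.  (1) The class maps `Λ, Λ′ : W → L²` (★ `E2Bootstrap.exists_clsMap₂`: linear, valued in `P` resp. `P′`, `R(1,g) Λ w = Λ (σ g w)`); `ψ` is
injective (irreducibility), so `Λ w₀ ≠ 0 ≠ Λ′ w₀` for any `w₀ ≠ 0` (★ `toLp_toQuotFun_ne_zero`).  (2) SCHUR SCALING: the Gram forms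
`b(w,w′) = ⟪Λ w, Λ w′⟫`, `b′ = ⟪Λ′ w, Λ′ w′⟫` are `U(J)(𝔸_{F,f})`-invariant (`R` unitary, ★ `inner_rightRegular_rightRegular`); Schur for invariant
sesquilinear forms (★ `F0P2aStubS1SesqSchur.stubS1_holds`) applied on `V := L² ⊕₂ L²` to `φ₁ = (Λ, Λ′)`, `φ₂ = (0, Λ′)` gives `b′ = c·(b + b′)`, whence
`‖Λ w₀‖² · b′ = ‖Λ′ w₀‖² · b`, i.e. `b′ = κ b` with `κ = ‖Λ′ w₀‖²∕‖Λ w₀‖² > 0` (the product trick is needed: with `V = L²` the cross form `⟪Λ w, Λ′ w′⟫`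
may vanish, e.g. when `P ⊥ P′`).  (3) EQUAL MATRIX COEFFICIENTS: for `x ∈ U(J)(𝔸_F)` write `x = sec(u) · k · (1,g)` (★
`exists_eq_adelicSingle_mul_kerArchAt_mul_finAdelicToAdelic`); `R(1,g) Λ w = Λ(σ g w)`, `R(k)` is TRIVIAL on hol-cotangent classes (clause (Kc) of
★ `mem_holCotForms₂_iff` + ★ `rightRegular_toLp_eq`), and the disc identity gives `⟪R(x) Λ w, Λ w′⟫ = m(u) · b(σ g w, w′)` — the same with `′`; so
the families `u w := √κ • Λ w ∈ P` and `u′ w := Λ′ w ∈ P′` have EQUAL matrix coefficients on `U(J)(𝔸_F)`.  (4) GNS uniqueness + multiplicity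
`≤ 1` (★ `E1pHilbert.eq_of_matrixCoeff_eq_of_multiplicity_le_one`, F0P5-p01 (g3)) ⇒ `P = P′`.
[Liu2021, App. D, proof of Prop. D.4]; [Rogawski1990, §11]; [Bump1997, Prop. 4.2.4] (Schur); [Folland1995, §3.3 Cor. 3.24] (GNS).

* part 1 = ★∕companion `Theorems/HLiu418E1pGram` (`toLp_eq_of_mem_Kc`, `inner_rightRegular_clsMap`, `clsMap_ne_zero`, `gram_eq_mul_gram`);
* §3 **`eq_of_discIdentity_of_holRealised`** (the core); §4 the heads modulo the two shapes (A) ∕ (C), and the final heads.  The CM head `curveCohFinComponentUnique_hol_of_curveMultiplicityLeOne` (file D, §4)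
  instantiates it at the letter's binders with A's `m` and C's `ψ, ψ′` once those files are ★.

## References
* [Liu2021] Y. Liu, *Hodge classes on unitary Shimura varieties* (2021), App. D, proof of Prop. D.4 (p. 130–131).
* [Rogawski1990] J. Rogawski, Ann. of Math. Stud. 123 (1990), §11.1 Prop. 11.1.1, §11.5 Thm. 11.5.1.
* [Bump1997] D. Bump, *Automorphic Forms and Representations* (1997), Prop. 4.2.4.  [Folland1995] G. B. Folland (1995), §3.3 Cor. 3.24.
* [BorelJacquet1979] A. Borel, H. Jacquet, Corvallis PSPM 33.1 (1979), §4.1, §4.6.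
-/

set_option autoImplicit false
-- the mandated namespace has the single-problem summit's repeated segment (`HodgeConjecture.HodgeConjecture`)
set_option linter.dupNamespace false

noncomputable section

open MeasureTheory NumberField NumberField.InfinitePlace
open scoped Matrix ComplexConjugate ComplexOrder InnerProductSpace ENNReal
open Literature.NumberTheory.Automorphic Literature.NumberTheory.Automorphic.UnitaryGroup
open Literature.NumberTheory.Automorphic.UnitaryGroup.CotangentForms (toQuotFun toQuotFun_mk)
open Literature.NumberTheory.Automorphic.UnitaryCurveForms
open Summit.HodgeConjecture.HodgeConjecture.Cruxes.H413.SpectrumJunction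
open Summit.HodgeConjecture.HodgeConjecture.Cruxes.HLiu418.E2Density
open Summit.HodgeConjecture.HodgeConjecture.Cruxes.HLiu418.E2Bootstrap
open Summit.HodgeConjecture.HodgeConjecture.Cruxes.HLiu418.E2ArchOrthHolPrep
open Summit.HodgeConjecture.HodgeConjecture.Cruxes.HLiu418.E1pGram

namespace Summit.HodgeConjecture.HodgeConjecture.Cruxes.HLiu418.E1pOfE1

variable {F E : Type} [Field F] [NumberField F] [Field E] [NumberField E] [Algebra F E]
  {c : E ≃ₐ[F] E} {J : Matrix (Fin 2) (Fin 2) E}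
  {hc : c ≠ 1} {hfix : ∀ w : InfinitePlace E, c • w = w} {w₁ : {w : InfinitePlace E // IsComplex w}} {𝔣 : ConeFrame E J w₁}
  {μ : Measure (adelicGroupData F E c 2 J).automorphicQuotient} [(adelicGroupData F E c 2 J).IsAutomorphicMeasure μ]
  [CompactSpace (adelicGroupData F E c 2 J).automorphicQuotient]

/-! ## §3 The core: disc identity with value + realisation in `Hol(P)`, `Hol(P′)` + multiplicity `≤ 1` ⇒ `P = P′` -/

/-- **E1′₂ BY THE RANK-2 COLLAPSE — THE CORE.**  See the module docstring: Schur scaling of the Gram forms of the two class maps (§2), the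
three-factor matrix coefficient with `K_c` idle and the disc identity with value (§1), and GNS uniqueness under multiplicity `≤ 1` (★
`E1pHilbert.eq_of_matrixCoeff_eq_of_multiplicity_le_one`). [cite: Liu2021, App. D, proof of Prop. D.4 (p. 130–131)]
[cite: Rogawski1990, §11.1 Prop. 11.1.1; §11.5 Thm. 11.5.1] [cite: Bump1997, Proposition 4.2.4] [cite: Folland1995, §3.3 Cor. 3.24] -/
theorem eq_of_discIdentity_of_holRealised {P P' : DiscreteAutomorphicRep (adelicGroupData F E c 2 J) μ}
    (hm1 : ((adelicGroupData F E c 2 J).rightRegular μ).multiplicity P.space.toContRep ≤ 1)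
    (m : archLocal E 2 J w₁ → ℂ)
    (hdisc : ∀ (h h₃ : (adelicGroupData F E c 2 J).Adelic → ℂ), h ∈ holCotForms₂ F E c J hc hfix w₁ 𝔣 → h₃ ∈ holCotForms₂ F E c J hc hfix w₁ 𝔣 →
      ∀ (hhm : MemLp (toQuotFun (adelicGroupData F E c 2 J) h) 2 μ) (hh₃m : MemLp (toQuotFun (adelicGroupData F E c 2 J) h₃) 2 μ)
        (u : archLocal E 2 J w₁),
        ⟪(adelicGroupData F E c 2 J).rightRegular μ (adelicSingle F E c 2 J hc hfix w₁ u) (hhm.toLp (toQuotFun (adelicGroupData F E c 2 J) h)),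
          hh₃m.toLp (toQuotFun (adelicGroupData F E c 2 J) h₃)⟫_ℂ =
        m u * ⟪hhm.toLp (toQuotFun (adelicGroupData F E c 2 J) h), hh₃m.toLp (toQuotFun (adelicGroupData F E c 2 J) h₃)⟫_ℂ)
    {W : Type} [AddCommGroup W] [Module ℂ W] (σ : Representation ℂ (finAdelic F E c 2 J) W) (hirr : σ.IsIrreducible) (hadm : σ.IsAdmissible)
    (ψ : W →ₗ[ℂ] ((adelicGroupData F E c 2 J).Adelic → ℂ))
    (hE : ∀ (k : finAdelic F E c 2 J) (w : W), ψ (σ k w) = rightRep₂ F E c J k (ψ w))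
    (hV : ∀ w, ψ w ∈ holCotForms₂ F E c J hc hfix w₁ 𝔣 ∧ P.ContainsFun (ψ w)) (hne : ψ ≠ 0)
    (ψ' : W →ₗ[ℂ] ((adelicGroupData F E c 2 J).Adelic → ℂ))
    (hE' : ∀ (k : finAdelic F E c 2 J) (w : W), ψ' (σ k w) = rightRep₂ F E c J k (ψ' w))
    (hV' : ∀ w, ψ' w ∈ holCotForms₂ F E c J hc hfix w₁ 𝔣 ∧ P'.ContainsFun (ψ' w)) (hne' : ψ' ≠ 0) : P = P' := by
  -- (1) the class maps and a test vector
  obtain ⟨Λ, hΛ, hΛP, hΛe⟩ := exists_clsMap₂ P σ ψ hE (fun w => leftInvariant_of_mem_holCotForms₂ (hV w).1) (fun w => (hV w).2)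
  obtain ⟨Λ', hΛ', hΛ'P, hΛ'e⟩ := exists_clsMap₂ P' σ ψ' hE' (fun w => leftInvariant_of_mem_holCotForms₂ (hV' w).1) (fun w => (hV' w).2)
  obtain ⟨w₀, hw₀⟩ : ∃ w₀ : W, w₀ ≠ 0 := by
    by_contra h
    push Not at h
    exact hne (LinearMap.ext fun w => by rw [h w, map_zero, LinearMap.zero_apply])
  have hΛ0 : Λ w₀ ≠ 0 := clsMap_ne_zero σ hirr ψ hE (fun w => (hV w).1) hne Λ hΛ hw₀
  have hΛ'0 : Λ' w₀ ≠ 0 := clsMap_ne_zero σ hirr ψ' hE' (fun w => (hV' w).1) hne' Λ' hΛ' hw₀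
  -- (2) Schur scaling: `A • b′ = B • b` with `A = ‖Λ w₀‖², B = ‖Λ′ w₀‖²`, both positive
  set A : ℝ := ‖Λ w₀‖ ^ 2 with hA
  set B : ℝ := ‖Λ' w₀‖ ^ 2 with hB
  have hApos : 0 < A := by positivity
  have hBpos : 0 < B := by positivity
  have hgram : ∀ w w' : W, (A : ℂ) * ⟪Λ' w, Λ' w'⟫_ℂ = (B : ℂ) * ⟪Λ w, Λ w'⟫_ℂ := gram_eq_mul_gram σ hirr hadm Λ Λ' hΛe hΛ'e w₀
  -- the scaling factor `s = √(B/A)`, `s² = B/A`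
  set s : ℝ := Real.sqrt (B / A) with hs
  have hs2 : (s : ℂ) * (s : ℂ) = (B : ℂ) / (A : ℂ) := by
    rw [← Complex.ofReal_mul, Real.mul_self_sqrt (div_pos hBpos hApos).le, Complex.ofReal_div]
  have hs0 : (s : ℂ) ≠ 0 := by
    rw [Complex.ofReal_ne_zero]
    exact (Real.sqrt_pos.2 (div_pos hBpos hApos)).ne'
  have hA0 : (A : ℂ) ≠ 0 := by exact_mod_cast hApos.ne'
  -- (3) the two families and their equal matrix coefficients
  let uu : W → P.space.toSubmodule := fun w => ⟨(s : ℂ) • Λ w, P.space.toSubmodule.smul_mem _ (hΛP w)⟩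
  let uu' : W → P'.space.toSubmodule := fun w => ⟨Λ' w, hΛ'P w⟩
  have h0 : uu w₀ ≠ 0 := by
    intro h
    have h' : (s : ℂ) • Λ w₀ = 0 := congrArg Subtype.val h
    exact hΛ0 ((smul_eq_zero.1 h').resolve_left hs0)
  have hcoeff : ∀ (x : (adelicGroupData F E c 2 J).Adelic) (w w' : W),
      ⟪(adelicGroupData F E c 2 J).rightRegular μ x (uu w : (adelicGroupData F E c 2 J).L2 μ), (uu w' : (adelicGroupData F E c 2 J).L2 μ)⟫_ℂ =
      ⟪(adelicGroupData F E c 2 J).rightRegular μ x (uu' w : (adelicGroupData F E c 2 J).L2 μ), (uu' w' : (adelicGroupData F E c 2 J).L2 μ)⟫_ℂ := by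
    intro x w w'
    obtain ⟨u, k, g, hk, rfl⟩ := exists_eq_adelicSingle_mul_kerArchAt_mul_finAdelicToAdelic F E c 2 J hc hfix w₁ x
    show ⟪(adelicGroupData F E c 2 J).rightRegular μ _ ((s : ℂ) • Λ w), (s : ℂ) • Λ w'⟫_ℂ =
      ⟪(adelicGroupData F E c 2 J).rightRegular μ _ (Λ' w), Λ' w'⟫_ℂ
    rw [map_smul, inner_smul_left, inner_smul_right, Complex.conj_ofReal,
      inner_rightRegular_clsMap m hdisc σ ψ (fun w => (hV w).1) Λ hΛ hΛe u hk g w w',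
      inner_rightRegular_clsMap m hdisc σ ψ' (fun w => (hV' w).1) Λ' hΛ' hΛ'e u hk g w w']
    -- `s · s · b(σ g w, w′) · m = m · b′(σ g w, w′)` by the Gram scaling
    have hg := hgram (σ g w) w'
    have hb' : ⟪Λ' (σ g w), Λ' w'⟫_ℂ = (B : ℂ) / (A : ℂ) * ⟪Λ (σ g w), Λ w'⟫_ℂ := by
      rw [div_mul_eq_mul_div, eq_div_iff hA0, mul_comm _ (A : ℂ)]
      exact hg
    rw [hb', ← hs2]
    ring
  -- (4) GNS uniqueness under multiplicity `≤ 1`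
  exact E1pHilbert.eq_of_matrixCoeff_eq_of_multiplicity_le_one hm1 uu uu' h0 hcoeff

/-! ## §4 At the letter binders: E1′₂ from E1₂ given the two heads (A: disc identity with value; C: `σ` realised in `Hol(P)`) -/

/-- **E1′₂ ⇐ E1₂ + (A) + (C), AT THE LETTER BINDERS.**  The CM specialisation of `eq_of_discIdentity_of_holRealised`: the compact quotient comes
from anisotropy (★ `S1BettiSliceExclusion.anisotropic_of_formCongr_posDef` + ★ `compactSpace_adelicGroupData_automorphicQuotient`), admissibility of
`σ` from ★ `E2LevelFinite.admissibleOfHolValued₂_holds`, multiplicity `≤ 1` from E1₂; the hypotheses `hA` (file A's head shape: a scalar `m` with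
the disc identity with value on hol-cotangent classes) and `hC` (file C's head shape: an irreducible smooth `σ` occurring in a hol-type `P` is
REALISED by a non-zero equivariant hol-valued `ψ` with classes in `P`) are the ∀-closures over the letter binders, so that the final head is the
two-token composition `curveCohFinComponentUnique_hol_of_shapes A.head C.head hE1`. [cite: Liu2021, App. D, proof of Prop. D.4 (p. 130–131)]
[cite: Rogawski1990, §11.1 Prop. 11.1.1; §11.5 Thm. 11.5.1] -/
theorem curveCohFinComponentUnique_hol_of_shapes
    (hA : ∀ (L : Type) [Field L] [NumberField L] [IsCMField L] (ι : L →+* ℂ) (H : Matrix (Fin 2) (Fin 2) L)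
      (dV : Fin 2 → L) (_hdV : ∀ i, IsCMField.complexConj L (dV i) = dV i) (_hdV0 : ∀ i, dV i ≠ 0)
      (t : L) (_ht : t ≠ 0) (g : GL (Fin 2) L),
      formCongr ((IsCMField.complexConj L : L ≃ₐ[↥(maximalRealSubfield L)] L) : L →+* L) g (t • H) = Matrix.diagonal dV →
      (∃ T : GL (Fin 2) ℂ, formCongr (starRingEnd ℂ) T ((Matrix.diagonal dV).map ι) = Matrix.diagonal ![(1 : ℂ), -1]) →
      (∀ τ' : L →+* ℂ, InfinitePlace.mk τ' ≠ InfinitePlace.mk ι → ((Matrix.diagonal dV).map τ').PosDef) →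
      4 ≤ Module.finrank ℚ L →
      ∀ (𝔣 : ConeFrame L H (cmPlace L ι))
        (μ : Measure (adelicGroupData (↥(maximalRealSubfield L)) L (IsCMField.complexConj L) 2 H).automorphicQuotient)
        [(adelicGroupData (↥(maximalRealSubfield L)) L (IsCMField.complexConj L) 2 H).IsAutomorphicMeasure μ],
      ∃ m : archLocal L 2 H (cmPlace L ι) → ℂ,
        ∀ (h h₃ : (adelicGroupData (↥(maximalRealSubfield L)) L (IsCMField.complexConj L) 2 H).Adelic → ℂ),
          h ∈ holCotForms₂ (↥(maximalRealSubfield L)) L (IsCMField.complexConj L) H (IsCMField.complexConj_ne_one L)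
            (UnitaryGroup.complexConj_smul_infinitePlace L) (cmPlace L ι) 𝔣 →
          h₃ ∈ holCotForms₂ (↥(maximalRealSubfield L)) L (IsCMField.complexConj L) H (IsCMField.complexConj_ne_one L)
            (UnitaryGroup.complexConj_smul_infinitePlace L) (cmPlace L ι) 𝔣 →
          ∀ (hhm : MemLp (toQuotFun (adelicGroupData (↥(maximalRealSubfield L)) L (IsCMField.complexConj L) 2 H) h) 2 μ)
            (hh₃m : MemLp (toQuotFun (adelicGroupData (↥(maximalRealSubfield L)) L (IsCMField.complexConj L) 2 H) h₃) 2 μ)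
            (u : archLocal L 2 H (cmPlace L ι)),
            ⟪(adelicGroupData (↥(maximalRealSubfield L)) L (IsCMField.complexConj L) 2 H).rightRegular μ
                (adelicSingle (↥(maximalRealSubfield L)) L (IsCMField.complexConj L) 2 H (IsCMField.complexConj_ne_one L)
                  (UnitaryGroup.complexConj_smul_infinitePlace L) (cmPlace L ι) u)
                (hhm.toLp (toQuotFun (adelicGroupData (↥(maximalRealSubfield L)) L (IsCMField.complexConj L) 2 H) h)),
              hh₃m.toLp (toQuotFun (adelicGroupData (↥(maximalRealSubfield L)) L (IsCMField.complexConj L) 2 H) h₃)⟫_ℂ =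
            m u * ⟪hhm.toLp (toQuotFun (adelicGroupData (↥(maximalRealSubfield L)) L (IsCMField.complexConj L) 2 H) h),
              hh₃m.toLp (toQuotFun (adelicGroupData (↥(maximalRealSubfield L)) L (IsCMField.complexConj L) 2 H) h₃)⟫_ℂ)
    (hC : ∀ (L : Type) [Field L] [NumberField L] [IsCMField L] (ι : L →+* ℂ) (H : Matrix (Fin 2) (Fin 2) L)
      (dV : Fin 2 → L) (_hdV : ∀ i, IsCMField.complexConj L (dV i) = dV i) (_hdV0 : ∀ i, dV i ≠ 0)
      (t : L) (_ht : t ≠ 0) (g : GL (Fin 2) L),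
      formCongr ((IsCMField.complexConj L : L ≃ₐ[↥(maximalRealSubfield L)] L) : L →+* L) g (t • H) = Matrix.diagonal dV →
      (∃ T : GL (Fin 2) ℂ, formCongr (starRingEnd ℂ) T ((Matrix.diagonal dV).map ι) = Matrix.diagonal ![(1 : ℂ), -1]) →
      (∀ τ' : L →+* ℂ, InfinitePlace.mk τ' ≠ InfinitePlace.mk ι → ((Matrix.diagonal dV).map τ').PosDef) →
      4 ≤ Module.finrank ℚ L →
      ∀ (𝔣 : ConeFrame L H (cmPlace L ι))
        (μ : Measure (adelicGroupData (↥(maximalRealSubfield L)) L (IsCMField.complexConj L) 2 H).automorphicQuotient)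
        [(adelicGroupData (↥(maximalRealSubfield L)) L (IsCMField.complexConj L) 2 H).IsAutomorphicMeasure μ]
        (W : Type) [AddCommGroup W] [Module ℂ W]
        (σ : Representation ℂ (finAdelic (↥(maximalRealSubfield L)) L (IsCMField.complexConj L) 2 H) W),
        σ.IsIrreducible → σ.IsSmooth →
      ∀ P : DiscreteAutomorphicRep (adelicGroupData (↥(maximalRealSubfield L)) L (IsCMField.complexConj L) 2 H) μ,
        P.IsHolCotangentAt₂ (IsCMField.complexConj_ne_one L) (UnitaryGroup.complexConj_smul_infinitePlace L) (cmPlace L ι) 𝔣 →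
        P.HasFinComponent σ →
        ∃ ψ : W →ₗ[ℂ] ((adelicGroupData (↥(maximalRealSubfield L)) L (IsCMField.complexConj L) 2 H).Adelic → ℂ),
          (∀ (k : finAdelic (↥(maximalRealSubfield L)) L (IsCMField.complexConj L) 2 H) (w : W),
              ψ (σ k w) = rightRep₂ (↥(maximalRealSubfield L)) L (IsCMField.complexConj L) H k (ψ w)) ∧
          (∀ w : W, ψ w ∈ holCotForms₂ (↥(maximalRealSubfield L)) L (IsCMField.complexConj L) H (IsCMField.complexConj_ne_one L)
              (UnitaryGroup.complexConj_smul_infinitePlace L) (cmPlace L ι) 𝔣 ∧ P.ContainsFun (ψ w)) ∧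
          ψ ≠ 0)
    (hE1 : Literature.NumberTheory.Rogawski1990.curveMultiplicityLeOne) :
    Literature.NumberTheory.Rogawski1990.curveCohFinComponentUnique_hol := by
  intro L _ _ _ ι H dV hdV hdV0 t ht g hg hsig hdef h4 𝔣 μ _ W _ _ σ hirr hsm P P' hP hP' hj hj'
  -- compact quotient from anisotropy (one definite place suffices)
  obtain ⟨τ, hτ⟩ := UnitaryGroup.exists_infinitePlace_ne L h4 ι
  have hanis := S1BettiSliceExclusion.anisotropic_of_formCongr_posDef L H t g dV hg τ (hdef τ hτ)
  haveI := UnitaryGroup.compactSpace_adelicGroupData_automorphicQuotient L 2 H hanis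
  -- the two heads
  obtain ⟨m, hm⟩ := hA L ι H dV hdV hdV0 t ht g hg hsig hdef h4 𝔣 μ
  obtain ⟨ψ, hE, hV, hne⟩ := hC L ι H dV hdV hdV0 t ht g hg hsig hdef h4 𝔣 μ W σ hirr hsm P hP hj
  obtain ⟨ψ', hE', hV', hne'⟩ := hC L ι H dV hdV hdV0 t ht g hg hsig hdef h4 𝔣 μ W σ hirr hsm P' hP' hj'
  -- admissibility of `σ` (★ S3₂) and multiplicity `≤ 1` (E1₂)
  have hadm : σ.IsAdmissible :=
    E2LevelFinite.admissibleOfHolValued₂_holds L ι H dV hdV hdV0 t ht g hg hsig hdef h4 𝔣 μ P W σ hirr hsm ψ hE hV hne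
  exact eq_of_discIdentity_of_holRealised (hE1 L ι H dV hdV hdV0 t ht g hg hsig hdef h4 μ P) m hm σ hirr hadm ψ hE hV hne ψ' hE' hV' hne'

/-- The antiholomorphic twin under the same heads (★ `UnitaryCurveForms.curveCohFinComponentUnique_antihol_of_hol`).
[cite: Liu2021, App. D, proof of Prop. D.4 (p. 130–131)] [cite: BorelWallach2000, VII 2.10] -/
theorem curveCohFinComponentUnique_antihol_of_shapes
    (hA : ∀ (L : Type) [Field L] [NumberField L] [IsCMField L] (ι : L →+* ℂ) (H : Matrix (Fin 2) (Fin 2) L)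
      (dV : Fin 2 → L) (_hdV : ∀ i, IsCMField.complexConj L (dV i) = dV i) (_hdV0 : ∀ i, dV i ≠ 0)
      (t : L) (_ht : t ≠ 0) (g : GL (Fin 2) L),
      formCongr ((IsCMField.complexConj L : L ≃ₐ[↥(maximalRealSubfield L)] L) : L →+* L) g (t • H) = Matrix.diagonal dV →
      (∃ T : GL (Fin 2) ℂ, formCongr (starRingEnd ℂ) T ((Matrix.diagonal dV).map ι) = Matrix.diagonal ![(1 : ℂ), -1]) →
      (∀ τ' : L →+* ℂ, InfinitePlace.mk τ' ≠ InfinitePlace.mk ι → ((Matrix.diagonal dV).map τ').PosDef) →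
      4 ≤ Module.finrank ℚ L →
      ∀ (𝔣 : ConeFrame L H (cmPlace L ι))
        (μ : Measure (adelicGroupData (↥(maximalRealSubfield L)) L (IsCMField.complexConj L) 2 H).automorphicQuotient)
        [(adelicGroupData (↥(maximalRealSubfield L)) L (IsCMField.complexConj L) 2 H).IsAutomorphicMeasure μ],
      ∃ m : archLocal L 2 H (cmPlace L ι) → ℂ,
        ∀ (h h₃ : (adelicGroupData (↥(maximalRealSubfield L)) L (IsCMField.complexConj L) 2 H).Adelic → ℂ),
          h ∈ holCotForms₂ (↥(maximalRealSubfield L)) L (IsCMField.complexConj L) H (IsCMField.complexConj_ne_one L)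
            (UnitaryGroup.complexConj_smul_infinitePlace L) (cmPlace L ι) 𝔣 →
          h₃ ∈ holCotForms₂ (↥(maximalRealSubfield L)) L (IsCMField.complexConj L) H (IsCMField.complexConj_ne_one L)
            (UnitaryGroup.complexConj_smul_infinitePlace L) (cmPlace L ι) 𝔣 →
          ∀ (hhm : MemLp (toQuotFun (adelicGroupData (↥(maximalRealSubfield L)) L (IsCMField.complexConj L) 2 H) h) 2 μ)
            (hh₃m : MemLp (toQuotFun (adelicGroupData (↥(maximalRealSubfield L)) L (IsCMField.complexConj L) 2 H) h₃) 2 μ)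
            (u : archLocal L 2 H (cmPlace L ι)),
            ⟪(adelicGroupData (↥(maximalRealSubfield L)) L (IsCMField.complexConj L) 2 H).rightRegular μ
                (adelicSingle (↥(maximalRealSubfield L)) L (IsCMField.complexConj L) 2 H (IsCMField.complexConj_ne_one L)
                  (UnitaryGroup.complexConj_smul_infinitePlace L) (cmPlace L ι) u)
                (hhm.toLp (toQuotFun (adelicGroupData (↥(maximalRealSubfield L)) L (IsCMField.complexConj L) 2 H) h)),
              hh₃m.toLp (toQuotFun (adelicGroupData (↥(maximalRealSubfield L)) L (IsCMField.complexConj L) 2 H) h₃)⟫_ℂ =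
            m u * ⟪hhm.toLp (toQuotFun (adelicGroupData (↥(maximalRealSubfield L)) L (IsCMField.complexConj L) 2 H) h),
              hh₃m.toLp (toQuotFun (adelicGroupData (↥(maximalRealSubfield L)) L (IsCMField.complexConj L) 2 H) h₃)⟫_ℂ)
    (hC : ∀ (L : Type) [Field L] [NumberField L] [IsCMField L] (ι : L →+* ℂ) (H : Matrix (Fin 2) (Fin 2) L)
      (dV : Fin 2 → L) (_hdV : ∀ i, IsCMField.complexConj L (dV i) = dV i) (_hdV0 : ∀ i, dV i ≠ 0)
      (t : L) (_ht : t ≠ 0) (g : GL (Fin 2) L),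
      formCongr ((IsCMField.complexConj L : L ≃ₐ[↥(maximalRealSubfield L)] L) : L →+* L) g (t • H) = Matrix.diagonal dV →
      (∃ T : GL (Fin 2) ℂ, formCongr (starRingEnd ℂ) T ((Matrix.diagonal dV).map ι) = Matrix.diagonal ![(1 : ℂ), -1]) →
      (∀ τ' : L →+* ℂ, InfinitePlace.mk τ' ≠ InfinitePlace.mk ι → ((Matrix.diagonal dV).map τ').PosDef) →
      4 ≤ Module.finrank ℚ L →
      ∀ (𝔣 : ConeFrame L H (cmPlace L ι))
        (μ : Measure (adelicGroupData (↥(maximalRealSubfield L)) L (IsCMField.complexConj L) 2 H).automorphicQuotient)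
        [(adelicGroupData (↥(maximalRealSubfield L)) L (IsCMField.complexConj L) 2 H).IsAutomorphicMeasure μ]
        (W : Type) [AddCommGroup W] [Module ℂ W]
        (σ : Representation ℂ (finAdelic (↥(maximalRealSubfield L)) L (IsCMField.complexConj L) 2 H) W),
        σ.IsIrreducible → σ.IsSmooth →
      ∀ P : DiscreteAutomorphicRep (adelicGroupData (↥(maximalRealSubfield L)) L (IsCMField.complexConj L) 2 H) μ,
        P.IsHolCotangentAt₂ (IsCMField.complexConj_ne_one L) (UnitaryGroup.complexConj_smul_infinitePlace L) (cmPlace L ι) 𝔣 →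
        P.HasFinComponent σ →
        ∃ ψ : W →ₗ[ℂ] ((adelicGroupData (↥(maximalRealSubfield L)) L (IsCMField.complexConj L) 2 H).Adelic → ℂ),
          (∀ (k : finAdelic (↥(maximalRealSubfield L)) L (IsCMField.complexConj L) 2 H) (w : W),
              ψ (σ k w) = rightRep₂ (↥(maximalRealSubfield L)) L (IsCMField.complexConj L) H k (ψ w)) ∧
          (∀ w : W, ψ w ∈ holCotForms₂ (↥(maximalRealSubfield L)) L (IsCMField.complexConj L) H (IsCMField.complexConj_ne_one L)
              (UnitaryGroup.complexConj_smul_infinitePlace L) (cmPlace L ι) 𝔣 ∧ P.ContainsFun (ψ w)) ∧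
          ψ ≠ 0)
    (hE1 : Literature.NumberTheory.Rogawski1990.curveMultiplicityLeOne) :
    Literature.NumberTheory.Rogawski1990.curveCohFinComponentUnique_antihol :=
  curveCohFinComponentUnique_antihol_of_hol (curveCohFinComponentUnique_hol_of_shapes hA hC hE1)

/-! ## §5 THE ROAD'S HEAD: `curveCohFinComponentUnique_hol` ⇐ `curveMultiplicityLeOne` ALONE (edition 2)

The two shapes (A), (C) consumed by §4 are now theorems of the tree — ★ `E1pRealise.archCoefficient_shape` (the disc identity with value,
★ `E1pArchCoefficient.exists_archCoefficient`, F0P5-p02 (g3) p807791) and ★ `E1pRealise.holValued_shape` (the realisation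
`E1pRealise.exists_holValued_of_hasFinComponent`, F0P5-p02 (g3), over ★ `E1pLevel` of A-p02 (g19) p808960 and ★ `E1pHilbert` of
F0P5-p01 (g3) p807900) — so the named fact `Rogawski1990.curveCohFinComponentUnique_hol` (and its mirror `_antihol`) follows from
`Rogawski1990.curveMultiplicityLeOne` with NO further hypothesis: the K-lane letter E1′₂ is DISCHARGED modulo E1₂ (net floor-0 debt −1). -/

/-- **THE HEAD OF THE COLLAPSE ROAD (holomorphic side).**  `curveMultiplicityLeOne → curveCohFinComponentUnique_hol`: two discrete automorphic
constituents of the compact unitary group `U(H)`, `H` of signature `(1,1)` at the CM place and definite elsewhere, which are holomorphic-cotangent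
for the same cone frame and share an irreducible smooth finite component `σ`, are EQUAL — from multiplicity `≤ 1` alone, by §4
(`curveCohFinComponentUnique_hol_of_shapes`) fed with ★ `E1pRealise.archCoefficient_shape` and ★ `E1pRealise.holValued_shape`.
[cite: Rogawski1990, §13.3 and Thm. 13.3.6] [cite: Liu2021, App. D §D.1–§D.3] [cite: Borel1997, §5.13–§5.14 and §15] [cite: BorelJacquet1979, §4.6] -/
theorem curveCohFinComponentUnique_hol_of_curveMultiplicityLeOne
    (hE1 : Literature.NumberTheory.Rogawski1990.curveMultiplicityLeOne) :
    Literature.NumberTheory.Rogawski1990.curveCohFinComponentUnique_hol :=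
  curveCohFinComponentUnique_hol_of_shapes E1pRealise.archCoefficient_shape E1pRealise.holValued_shape hE1

/-- **THE HEAD OF THE COLLAPSE ROAD (anti-holomorphic side).**  `curveMultiplicityLeOne → curveCohFinComponentUnique_antihol`, by the mirror
★ `UnitaryCurveForms.curveCohFinComponentUnique_antihol_of_hol` applied to the holomorphic head.
[cite: Rogawski1990, §13.3 and Thm. 13.3.6] [cite: Liu2021, App. D §D.1–§D.3] -/
theorem curveCohFinComponentUnique_antihol_of_curveMultiplicityLeOne
    (hE1 : Literature.NumberTheory.Rogawski1990.curveMultiplicityLeOne) :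
    Literature.NumberTheory.Rogawski1990.curveCohFinComponentUnique_antihol :=
  curveCohFinComponentUnique_antihol_of_hol (curveCohFinComponentUnique_hol_of_curveMultiplicityLeOne hE1)

end Summit.HodgeConjecture.HodgeConjecture.Cruxes.HLiu418.E1pOfE1

end
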